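import Summits.BirchSwinnertonDyer.BirchSwinnertonDyer.Theorems.AdditiveBranchIMCGordTwoTwistedFieldOne
import Summits.BirchSwinnertonDyer.BirchSwinnertonDyer.Theorems.AdditiveBranchIMCGordTwoRankOneWanAnyRoadClosedHL
import HarnessLib

/-!
# THE RANK-ONE TWISTED WAN ROAD, CLOSED MODULO ITS JOINT LOWER HALF (crux 19358 `GordTwoRankOne`, line `wan_tame_bdp_road`,
# stub `stub_twistedWanChain`; pen bsd-addord-plan g46, E368 — the r₁ MIRROR of LEAD g15's
# `Theorems/AdditiveBranchIMCGordTwoTwistedChainR0.lean` (p802099, `TwistedWanRoad.twistedWanChainR0_of_jointLower`)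

Theorems only (a DRAFT, r2 = r1 + the cut binder `¬ p ∣ q + 1` in `hJLT`, supplied from the cut's own clause; landable VERBATIM as
`Theorems/AdditiveBranchIMCGordTwoTwistedChain.lean --supports stmt-BirchSwinnertonDyer-19358 --as helper`).

The field-explicit RANK-ONE kernel `WanAnyRoad.missingLowerBoundAt_rankOne_of_tameRoadFieldAny_tenFacts` (p779477, file `…WanAnyRoadClosedHL`)
has TWO fields only: FIELD 1 = the joint lower half `JointLowerBoundAt E Wd p` over the road field `K` (♭-inclusion ⟹ branch socket ⟹ Step L
⟹ joint lower half, §6–§8 of the E2 port), and the rank-zero twist's UPPER half `ClassX4Gord.missingUpperBoundAt_rankZero_of_katoHalf` (Kato's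
half-eigen divisibility, Wuthrich 2014 + Delbourgo 1998 Prop. 4; NO Tamagawa / Manin / genus-field input). On the TWISTED road (`E` additive,
potentially multiplicative at the road prime `q`; `K` a `TwistedWanRoad.TameRoadFieldTwisted`) the second field is VERBATIM (the twist
`Wd ≅ E^{(d_K)}` lies on the cell with `ρ̄` onto by `ThreeFieldRoadSupply.cellGordTwo_tameTwist` / `surj_tameTwist`, whose hypotheses — `K`
imaginary quadratic, `p` split, `2` split — are clauses of `TameRoadFieldTwisted`), so — unlike the rank-zero road (FIELD 2 = design D2,
`exists_fieldTwo_twisted`, with its mod-8 side condition) — the rank-one road needs NO second cut and NO side condition. What is NOT in the tree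
is FIELD 1 over a twisted road field (`WanAnyRoad.jointLowerBoundAt_…` asks `TameRoadFieldAny`: `q` multiplicative for `E`) — the Hsieh
ν-branch / CLW / LZZ readings (R2–R4, typed p790160 / p790378 / p791091). This file proves the r₁ chain MODULO that one input, taken as an
explicit hypothesis (the SAME input as the LEAD's r₀ `stub_jointLowerTwistedR0`, with the two analytic ranks swapped):

* `missingLowerBoundAt_rankOne_twisted_of_jointLower` — field-explicit form (`K`, `Wd`, and `JointLowerBoundAt E Wd p` given);
* `twistedWanChain_of_jointLower` — the registered stub's shape: `FieldOneTwistedCutOne →` (four printed facts) `→` (joint lower half on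
  twisted road fields, rank-one keyed) `→ ∀ E p, r_an = 1 → cell → TwistedWanRoadRowCutOne E p → MissingLowerBoundAt E p`.

BSD is proved for no curve by this file: both theorems are conditional on printed facts and on the twisted joint lower half.
References: [Kato2004Asterisque] Thm. 17.4 (3); [Delbourgo1998] Prop. 4; [Wuthrich2014] §5; [FriedbergHoffstein1995] Thm. B; [HoffsteinLuo1997] Thm.;
[CastellaLiuWan2022] Thm. 8.2.1 (1); [Hsieh2014] Thm. B; [LiuZhangZhang2018] Thm. 1.5.1/1.5.3.
-/

set_option linter.dupNamespace false
set_option autoImplicit false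

noncomputable section

open scoped Classical

open WeierstrassCurve IsDedekindDomain IsDedekindDomain.HeightOneSpectrum NumberField Rat.HeightOneSpectrum
  Literature.NumberTheory.EllipticCurves Literature.NumberTheory.EllipticCurves.ModularForms
  Literature.NumberTheory.EllipticCurves.Rank1Residual Literature.NumberTheory.EllipticCurves.Rank1Residual.Typed
  Literature.NumberTheory.QuadraticFields
  Summit.BirchSwinnertonDyer.Rank1Residual Summit.BirchSwinnertonDyer.Rank1Residual.Additive
  Summit.BirchSwinnertonDyer.BirchSwinnertonDyer.Theorems

namespace Summit.BirchSwinnertonDyer.BirchSwinnertonDyer.Theorems.TwistedWanRoad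

open Field ThreeFieldRoadSupply WanAnyRoad TwistRowRankOneClosedHL

/-- **The rank-one twisted Wan road, field-explicit, modulo FIELD 1.** For `E` of analytic rank `1` on cell (G-ord, `e = 2`), `p ≥ 5`, `ρ̄`
onto, a twisted road field `K` at `q` (`TameRoadFieldTwisted W p q K`), a globally minimal `Wd ≅ E^{(d_K)}` of analytic rank `0`, and the
joint lower half `JointLowerBoundAt E Wd p`: `MissingLowerBoundAt E p`. Proof: the twist lies on the cell with `ρ̄` onto
(`cellGordTwo_tameTwist`, `surj_tameTwist`; `2` splits in `K` by the road-field clauses, split at the bad primes `≠ q` if `2 ∣ N_E`, by the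
`2 ∤ N_E` clause otherwise, `q` being odd); its upper half is Kato's (`ClassX4Gord.missingUpperBoundAt_rankZero_of_katoHalf`); then
`missingLowerBoundAt_of_joint_of_upper`. [cite: Kato2004Asterisque, Thm. 17.4 (3) (p. 273)] [cite: Delbourgo1998, Prop. 4]
[cite: SilvermanAEC2009, X.5 Cor. 5.4 and VII.5 Prop. 5.1] -/
theorem missingLowerBoundAt_rankOne_twisted_of_jointLower
    (hWu : Wuthrich2014.kato_halfEigenCharIdeal_dvd_cyclotomicPrime_of_surjective)
    (hDel : Delbourgo1998.prop4_rankZero_pow_dvd_constantCoeff)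
    (hGZK : rank_eq_analyticRank_of_analyticRank_le_one) (hmodP : nonempty_modularParametrizationData)
    (W : WeierstrassCurve ℚ) [W.IsElliptic] [W.IsGloballyMinimal] (p : ℕ) [hp : Fact p.Prime]
    (hcell : N10.CellGordTwo W p) (hp5 : 5 ≤ p) (hsurj : Surj W p)
    {q : ℕ} [hq : Fact q.Prime] (K : Type) [Field K] [NumberField K] (hK : TameRoadFieldTwisted W p q K)
    (Wd : WeierstrassCurve ℚ) [Wd.IsElliptic] [Wd.IsGloballyMinimal]
    (Cd : VariableChange ℚ) (hWd : Cd • W.quadraticTwist (NumberField.discr K : ℚ) = Wd) (hrd : Wd.analyticRank = 0)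
    (hJL : JointLowerBoundAt W Wd p) :
    MissingLowerBoundAt W p := by
  -- derived facts (tree theorems), as in the r₁ kernel
  have hnf : exists_isNewformOf := exists_isNewformOf_of_nonempty_modularParametrizationData hmodP
  have hmod : hasEntireLFunction_rat := WeierstrassCurve.hasEntireLFunction_rat_of_exists_isNewformOf hnf
  -- the transports along `Wd ≅ E^{(d_K)}`
  have hK' := hK
  obtain ⟨hKiq, -, htw, -, hsplit, h2split, hHeeg⟩ := hK'
  obtain ⟨-, hq2, -, -, -⟩ := htw
  have h2K : ((Ideal.span {(2 : ℤ)}).primesOver (𝓞 K)).ncard = 2 := by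
    by_cases h2N : 2 ∣ W.conductorNorm ℤ
    · exact hsplit 2 Nat.prime_two h2N (Ne.symm hq2)
    · exact h2split h2N
  have hcelld : N10.CellGordTwo Wd p := cellGordTwo_tameTwist W p K hp5 hKiq hHeeg h2K Cd hWd hcell
  have hsurjd : Surj Wd p := surj_tameTwist W p K Cd hWd hsurj
  -- the twist's upper half from the tree (rank `0`, `ρ̄` onto, `p ≥ 5`)
  have hX4 : ClassX4Gord Wd p :=
    ⟨⟨hcelld.1, hcelld.2.1, hasIrreducibleModPGaloisRep_of_hasSurjectiveModNGaloisRep Wd p hsurjd⟩, hcelld.2.2.1⟩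
  have hed : semistabilityIndex Wd p = 2 := hcelld.2.2.2
  have hram3 : p = 3 → Ram Wd p := fun h3 ↦ absurd h3 (by omega)
  exact missingLowerBoundAt_of_joint_of_upper hJL
    (ClassX4Gord.missingUpperBoundAt_rankZero_of_katoHalf hWu hDel hGZK hmod hmodP hX4 hed hrd hsurjd hram3)

/-- **The registered stub `stub_twistedWanChain`'s shape, modulo the twisted joint lower half (rank-one keyed).** From the field-one supply
`FieldOneTwistedCutOne` (landed: `fieldOneTwistedCutOne_of_fh`, p797996, fed by Friedberg–Hoffstein's prescribed-splitting instance ⟸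
Hoffstein–Luo + modularity), four printed facts, and the joint lower half over twisted road fields on the cut `p ∤ q + 1` (the one unported field of the r₁ kernel):
every `E` of analytic rank `1` on cell (G-ord, `e = 2`) on the cut `TwistedWanRoadRowCutOne` (case A, `E` not additive at `2`) has
`MissingLowerBoundAt E p`. No mod-8 side condition (the r₁ road has no genus field). [cite: Kato2004Asterisque, Thm. 17.4 (3) (p. 273)]
[cite: Delbourgo1998, Prop. 4] [cite: FriedbergHoffstein1995, Thm. B] [cite: HoffsteinLuo1997, Theorem (§1, pp. 435–436)] -/
theorem twistedWanChain_of_jointLower (hF1 : FieldOneTwistedCutOne)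
    (hWu : Wuthrich2014.kato_halfEigenCharIdeal_dvd_cyclotomicPrime_of_surjective)
    (hDel : Delbourgo1998.prop4_rankZero_pow_dvd_constantCoeff)
    (hGZK : rank_eq_analyticRank_of_analyticRank_le_one) (hmodP : nonempty_modularParametrizationData)
    (hJLT : ∀ (W : WeierstrassCurve ℚ) [W.IsElliptic] [W.IsGloballyMinimal] (p : ℕ) [Fact p.Prime] (q : ℕ) [Fact q.Prime]
      (K : Type) [Field K] [NumberField K] (Wd : WeierstrassCurve ℚ) [Wd.IsElliptic] [Wd.IsGloballyMinimal],
      W.analyticRank = 1 → N10.CellGordTwo W p → TwistedWanRoadRowCutOne W p → TameRoadFieldTwisted W p q K →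
      ¬ p ∣ q + 1 → (∃ C : VariableChange ℚ, C • W.quadraticTwist (NumberField.discr K : ℚ) = Wd) → Wd.analyticRank = 0 →
      JointLowerBoundAt W Wd p)
    (W : WeierstrassCurve ℚ) [W.IsElliptic] [W.IsGloballyMinimal] (p : ℕ) [hp : Fact p.Prime]
    (hr : W.analyticRank = 1) (hcell : N10.CellGordTwo W p) (hrow : TwistedWanRoadRowCutOne W p) :
    MissingLowerBoundAt W p := by
  have hnf : exists_isNewformOf := exists_isNewformOf_of_nonempty_modularParametrizationData hmodP
  have hmod : hasEntireLFunction_rat := WeierstrassCurve.hasEntireLFunction_rat_of_exists_isNewformOf hnf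
  have hpar : ∀ X : WeierstrassCurve ℚ, even_analyticRank_iff_rootNumber_eq_one X :=
    fun X ↦ even_analyticRank_iff_rootNumber_eq_one_of_exists_isNewformOf X hnf
  have hw : W.rootNumber = -1 := (rootNumber_of_analyticRank_le_one W hpar).2 hr
  have hrow' := hrow
  obtain ⟨⟨⟨hp5, hsurj, -, htt, -⟩, q, hq, htwq, -, hq1, -⟩, h2⟩ := hrow'
  have hp2 : p ≠ 2 := by omega
  -- FIELD 1's field `K` and the twist `Wd ≅ E^{(d_K)}` of analytic rank `0`
  obtain ⟨K, iF, iN, hK, -, hL⟩ := hF1 W hnf htt h2 hw p q hp.out hp2 htwq 0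
  have hD0 : (NumberField.discr K : ℚ) ≠ 0 := by exact_mod_cast NumberField.discr_ne_zero K
  obtain ⟨Wd, iWd, iWdm, Cd, hCd⟩ := exists_isGloballyMinimal_smul_eq_quadraticTwist W hD0
  have hWd : Cd⁻¹ • W.quadraticTwist (NumberField.discr K : ℚ) = Wd := by rw [← hCd, inv_smul_smul]
  have hrd : Wd.analyticRank = 0 := analyticRank_eq_zero_tameTwist W K hmod Cd⁻¹ hWd hL
  have hJL : JointLowerBoundAt W Wd p := hJLT W p q K Wd hr hcell hrow hK hq1 ⟨Cd⁻¹, hWd⟩ hrd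
  exact missingLowerBoundAt_rankOne_twisted_of_jointLower hWu hDel hGZK hmodP W p hcell hp5 hsurj K hK Wd Cd⁻¹ hWd hrd hJL

end Summit.BirchSwinnertonDyer.BirchSwinnertonDyer.Theorems.TwistedWanRoad

end
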